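import Summits.CriticalPhenomena.PercolationContinuityZ3.Theorems.PercNearOneGluingNoHeavyLowerTailSahiGridPatternTwoPayerCapPacking
import HarnessLib

/-!
# `NoHeavyLowerTail` (crux stmt-CriticalPhenomena-4575), Sahi programme P1: **CERTIFICATES OF A CYLINDER PROJECT TO (SCALED) CERTIFICATES OF THE BASE** (every dimension)

Support file (Sahi cell, seat `prim-sahi-p1`, generation 39; `--supports stmt-CriticalPhenomena-4575`).  Pure proofs, no definitions, no `sorry`, standard axioms.
Vocabulary of `…SahiGridPattern{CellForm,DiagCert}` (`cylSet`, `glue`, `thetaVal`, `lamU`, `nuCount`).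

THE MATHEMATICS (seat memo FROM-prim-sahi-p1-gen39 §2.4 "projection lemma").  Let `V ⊆ [3]^k` and let `d'` be a diagonal certificate of the cylinder `[3]^n × V`
(`cylSet V ⊆ [3]^{n+k}`): (N') `Θ_{cyl V}(A×A') ≤ d'(A∩A')` and (T') `d'(W) ≤ λ_{cyl V}(W)` for up-sets of `[3]^{n+k}`.  Summing out the free block,
`d(q) := Σ_ξ d'(glue ξ q)`, gives a vector on `[3]^k` satisfying the `6^n`-SCALED certificate conditions of `V`:
  (N) `6^n·Θ_V(A×A') ≤ d(A∩A')`   and   (T) `d(W) ≤ 6^n·λ_V(W)`   (all up-sets `A, A', W ⊆ [3]^k`),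
because the cylinders `cyl A, cyl A', cyl W` are up-sets, `cyl A ∩ cyl A' = cyl(A∩A')`, `Θ_{cyl V}(cyl A × cyl A') = 3^n·2^n·Θ_V(A×A')` (each of the `3^n` free points has
`2^n` totally distinct partners) and `λ_{cyl V}(glue ξ q) = 2^n·λ_V(q)`.  CONSEQUENCE (the converse of the cylinder rule `d ↦ 2^n·(1 ⊗ d)`): every linear functional
`w ⊗ 1` attains on the certificates of `cyl V` exactly `6^n` times its minimum over the (rational) certificates of `V`; in particular pure cylinder lifts of the generation-38
`k = 4` configurations of the two-payer star keep their LP margins up to the factor `6` (verified numerically at `k = 5`, kit j281071: 4176 = 6·696, …) — lifting alone never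
produces a violation.
* `sum_cylSet_eq` — `Σ_{x ∈ cyl A} f(x) = Σ_{q∈A} Σ_ξ f(glue ξ q)`;  `cylSet_inter` — `cyl A ∩ cyl A' = cyl(A∩A')`;
* `theta_cylSet_cylSet` — `Θ_{cyl V}(cyl A × cyl A') = 3^n·2^n·Θ_V(A×A')`;  `lamU_cylSet_sum` — `Σ_{x∈cyl W} λ_{cyl V}(x) = 3^n·2^n·λ_V(W)`;
* ★ `diagCert_cylSet_project` — the projection statement above.
Nothing here asserts `PatternPos d` for `d ≥ 4`. [this work]
-/

namespace Summit.CriticalPhenomena.PercolationContinuityZ3.Theorems.SahiGridPattern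

open Finset SahiGrid3
open scoped BigOperators

variable {n k : ℕ}

/-- Sum over a cylinder as an iterated sum over the base set and the free block. [this work] -/
theorem sum_cylSet_eq (A : Finset (Pd k)) (f : Pd (n + k) → ℤ) :
    (∑ x ∈ (cylSet A : Finset (Pd (n + k))), f x) = ∑ q ∈ A, ∑ ξ : Pd n, f (glue ξ q) := by
  classical
  rw [sum_mem_eq_sum_ind_mul (cylSet A : Finset (Pd (n + k))) f, sum_glue, Finset.sum_comm]
  simp_rw [ind_cylSet_glue]
  rw [← sum_ind_mul_eq_sum_mem A (fun q => ∑ ξ : Pd n, f (glue ξ q))]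
  refine Finset.sum_congr rfl fun q _ => ?_
  rw [Finset.mul_sum]

/-- Cylinders commute with intersection. [this work] -/
theorem cylSet_inter (A A' : Finset (Pd k)) :
    ((cylSet A : Finset (Pd (n + k))) ∩ (cylSet A' : Finset (Pd (n + k)))) = (cylSet (A ∩ A') : Finset (Pd (n + k))) := by
  ext x
  simp [mem_cylSet_iff]

/-- The number of ordered totally distinct pairs of the free block: `Σ_ξ Σ_η [ξ δ̸ η] = 3^n · 2^n`. [this work] -/
theorem sum_sum_totDist_eq (n : ℕ) :
    (∑ ξ : Pd n, ∑ η : Pd n, (if TotDist ξ η = true then (1:ℤ) else 0)) = 3 ^ n * 2 ^ n := by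
  have h : ∀ ξ : Pd n, (∑ η : Pd n, (if TotDist ξ η = true then (1:ℤ) else 0)) = 2 ^ n := by
    intro ξ
    have := sum_ite_totDist_eq_pow ξ
    simp_rw [totDist_symm _ ξ] at this ⊢
    simpa using this
  simp_rw [h]
  rw [Finset.sum_const, Finset.card_univ, nsmul_eq_mul]
  simp [Fintype.card_fin, Fintype.card_pi]

/-- `Θ` of a cylinder on a pair of cylinders: `Θ_{cyl V}(cyl A × cyl A') = 3^n·2^n·Θ_V(A×A')`. [this work] -/
theorem theta_cylSet_cylSet (V A A' : Finset (Pd k)) :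
    (∑ x ∈ (cylSet A : Finset (Pd (n + k))), ∑ y ∈ (cylSet A' : Finset (Pd (n + k))), thetaVal (cylSet V : Finset (Pd (n + k))) x y)
      = 3 ^ n * 2 ^ n * ∑ q ∈ A, ∑ r ∈ A', thetaVal V q r := by
  classical
  rw [sum_cylSet_eq]
  simp_rw [sum_cylSet_eq A', thetaVal_cylSet]
  -- Σ_{q∈A} Σ_ξ Σ_{r∈A'} Σ_η [ξ δ̸ η]·Θ_V(q,r)
  have h1 : ∀ q : Pd k, (∑ ξ : Pd n, ∑ r ∈ A', ∑ η : Pd n, (if TotDist ξ η = true then (1:ℤ) else 0) * thetaVal V q r)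
      = 3 ^ n * 2 ^ n * ∑ r ∈ A', thetaVal V q r := by
    intro q
    rw [Finset.sum_comm, Finset.mul_sum]
    refine Finset.sum_congr rfl fun r _ => ?_
    simp_rw [← Finset.sum_mul]
    rw [sum_sum_totDist_eq]
  simp_rw [h1]
  rw [← Finset.mul_sum]

/-- `λ` of a cylinder summed over a cylinder: `Σ_{x ∈ cyl W} λ_{cyl V}(x) = 3^n·2^n·λ_V(W)`. [this work] -/
theorem lamU_cylSet_sum (V W : Finset (Pd k)) :
    (∑ x ∈ (cylSet W : Finset (Pd (n + k))), lamU (cylSet V : Finset (Pd (n + k))) x) = 3 ^ n * 2 ^ n * ∑ q ∈ W, lamU V q := by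
  classical
  rw [sum_cylSet_eq]
  have h1 : ∀ (ξ : Pd n) (q : Pd k), lamU (cylSet V : Finset (Pd (n + k))) (glue ξ q) = 2 ^ n * lamU V q := by
    intro ξ q
    unfold lamU
    rw [ind_cylSet_glue, nuCount_cylSet, pow_add]
    ring
  simp_rw [h1]
  rw [Finset.mul_sum]
  refine Finset.sum_congr rfl fun q _ => ?_
  rw [Finset.sum_const, Finset.card_univ, nsmul_eq_mul]
  simp [Fintype.card_fin, Fintype.card_pi]
  ring

/-- **Certificates of a cylinder project to `6^n`-scaled certificates of the base** (every `n`, `k`).  If `d'` satisfies (N') and (T') for `cylSet V ⊆ [3]^{n+k}`,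
then `d(q) = Σ_ξ d'(glue ξ q)` satisfies `3^n·2^n·Θ_V(A×A') ≤ d(A∩A')` and `d(W) ≤ 3^n·2^n·λ_V(W)` for all up-sets `A, A', W ⊆ [3]^k`. [this work] -/
theorem diagCert_cylSet_project (V : Finset (Pd k)) (d' : Pd (n + k) → ℤ)
    (hN' : ∀ A A' : Finset (Pd (n + k)), IsUpperSet (A : Set (Pd (n + k))) → IsUpperSet (A' : Set (Pd (n + k))) →
      (∑ x ∈ A, ∑ y ∈ A', thetaVal (cylSet V : Finset (Pd (n + k))) x y) ≤ ∑ x ∈ A ∩ A', d' x)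
    (hT' : ∀ W : Finset (Pd (n + k)), IsUpperSet (W : Set (Pd (n + k))) → (∑ x ∈ W, d' x) ≤ ∑ x ∈ W, lamU (cylSet V : Finset (Pd (n + k))) x) :
    (∀ A A' : Finset (Pd k), IsUpperSet (A : Set (Pd k)) → IsUpperSet (A' : Set (Pd k)) →
        3 ^ n * 2 ^ n * (∑ q ∈ A, ∑ r ∈ A', thetaVal V q r) ≤ ∑ q ∈ A ∩ A', ∑ ξ : Pd n, d' (glue ξ q)) ∧
    (∀ W : Finset (Pd k), IsUpperSet (W : Set (Pd k)) →
        (∑ q ∈ W, ∑ ξ : Pd n, d' (glue ξ q)) ≤ 3 ^ n * 2 ^ n * ∑ q ∈ W, lamU V q) := by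
  classical
  refine ⟨fun A A' hA hA' => ?_, fun W hW => ?_⟩
  · have h := hN' (cylSet A) (cylSet A') (isUpperSet_cylSet hA) (isUpperSet_cylSet hA')
    rw [theta_cylSet_cylSet, cylSet_inter, sum_cylSet_eq] at h
    exact h
  · have h := hT' (cylSet W) (isUpperSet_cylSet hW)
    rw [lamU_cylSet_sum, sum_cylSet_eq] at h
    exact h

end Summit.CriticalPhenomena.PercolationContinuityZ3.Theorems.SahiGridPattern
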